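import Summits.Ventures.PackingBounds.Energy.TenPointPetQ1Defs
import HarnessLib

/-!
# `TenPointPetQ1`: the value of the bound `10(9c - F(1,1,1) - A(1)) = 20588575/139968`

Framing: lottery ticket; floor = certified bounds/negative ranges. Venture `PackingBounds`, cell
`pub-packcert`, energy family E3PT (pub-packcert-energy gen 14; n = 4 kernel route = KERNEL-D6 data route + `threePointF 4`).
-/

noncomputable section

namespace Summit.Ventures.PackingBounds.Energy.TenPointPetQ1

set_option maxRecDepth 20000 in
set_option maxHeartbeats 400000000 in
/-- The value of the bound: `10(9c - F(1,1,1) - A(1)) = 20588575/139968` (the `(1 + t) ^ 7 * (t + 2 / 3)`-energy of the configuration 'Petersen code (4,10,1/6)' over ordered pairs). -/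
theorem bound_eqPQ1 : (10 : ℝ) * ((10 - 1) * c0KPQ1 - FexpKPQ1 1 1 1 - aPolyKPQ1 1) = ((20588575 : ℝ)/139968) := by
  unfold c0KPQ1 FexpKPQ1 aPolyKPQ1; ring

end Summit.Ventures.PackingBounds.Energy.TenPointPetQ1
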